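import Mathlib
import Summits.QuantumFields.QCD.Theses.PauliWegnerSea

/-!
# Single-link flatness of the Wilson sea (route `PauliWegnerSea`, item stmt-QuantumFields-11515)

We prove `Summit.QuantumFields.QCD.Theses.PauliWegnerSea.SingleLinkFlatness`: there is ONE constant
`C` such that for every torus side `L`, every `SU(3)` background `U`, bare mass `m₀`, edge `e` and
`g₀ ∈ SU(3)`,
`‖det D_W(U[e ↦ g₀]; m₀, r = 1)‖² ≤ C ∫ ‖det D_W(U[e ↦ g]; m₀, 1)‖² d Haar(g)`.

## Proof (finite-dimensionality, "β-free Nikolskii flatness")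

1. `exists_sq_le_mul_integral_sq` (Nikolskii-type inequality): on a compact space `X` with a
   finite Borel measure `μ` charging every non-empty open set, a finite-dimensional subspace
   `W ⊆ C(X, ℂ)` admits `C_W` with `‖f x‖² ≤ C_W ∫ ‖f‖² dμ` for all `f ∈ W`, `x ∈ X`:
   `ContinuousMap.toLp 2 μ ℂ` is injective, and the inverse on the finite-dimensional image
   `W.map toLp ⊆ L²(μ)` is a linear map out of a finite-dimensional normed space, hence bounded
   into the sup-normed space `C(X, ℂ)`.
2. `totalDegree_det_le_of_entries`: if the `(i, j)` entry of a matrix of multivariate polynomials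
   has total degree `≤ a i + b j`, the determinant has total degree `≤ ∑ a + ∑ b` (Leibniz formula).
3. `det_wilsonDirac_update_eq_eval`: the entries of `wilsonDirac ρ (update U e g) m r` (`ρ` the
   fundamental representation of `SU(3)`) are evaluations, at the `18` numbers (entries of `g`,
   entries of `g⁻¹`), of polynomials of total degree `≤ [p.1 = e.1] + [q.1 = e.1]`: the link
   variable `g` enters only the `12` rows at the site `e.1` and `g⁻¹` only the `12` columns at
   `e.1`.  Hence `g ↦ det D_W(U[e ↦ g])` is the evaluation of a polynomial of total degree `≤ 24`
   in `18` variables for EVERY `L, U, m₀, e` — one fixed finite-dimensional space of continuous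
   functions on `SU(3)`, to which step 1 applies with `μ` the Haar probability measure.

No new definitions are introduced (the polynomial bookkeeping is phrased as existence statements;
`SU3`, `LinkVar` and the coordinate vector `⦗g⦘` are local notations).
-/

noncomputable section

namespace Summit.QuantumFields.QCD.Theorems.PauliWegnerSea

open scoped BigOperators ENNReal
open MeasureTheory MvPolynomial
open Literature.MathematicalPhysics.QuantumFieldTheory Literature.MathematicalPhysics.QuantumLattice
  Literature.Probability.LatticeModels

/-! ## Step 1: a Nikolskii-type inequality on finite-dimensional spaces of continuous functions -/

/-- **Nikolskii-type inequality.** On a compact space with a finite Borel measure that charges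
every non-empty open set, every finite-dimensional subspace `W ⊆ C(X, ℂ)` admits a constant `C`
with `‖f x‖ ^ 2 ≤ C * ∫ ‖f y‖ ^ 2 dμ` for all `f ∈ W` and all points `x` (all norms on a
finite-dimensional space are equivalent; the `L²(μ)`-seminorm is a norm on continuous functions
because `μ` has full support). [folklore] -/
theorem exists_sq_le_mul_integral_sq {X : Type*} [TopologicalSpace X] [CompactSpace X]
    [MeasurableSpace X] [BorelSpace X] (μ : Measure X) [IsFiniteMeasure μ] [μ.IsOpenPosMeasure]
    (W : Submodule ℂ C(X, ℂ)) [FiniteDimensional ℂ W] :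
    ∃ C : ℝ, ∀ f ∈ W, ∀ x : X, ‖f x‖ ^ 2 ≤ C * ∫ y, ‖f y‖ ^ 2 ∂μ := by
  set T : C(X, ℂ) →L[ℂ] Lp ℂ 2 μ := ContinuousMap.toLp 2 μ ℂ with hT_def
  have hT : Function.Injective T := ContinuousMap.toLp_injective μ
  let Tl : C(X, ℂ) →ₗ[ℂ] Lp ℂ 2 μ := (T : C(X, ℂ) →ₗ[ℂ] Lp ℂ 2 μ)
  have hTl : Function.Injective Tl := hT
  let W₂ : Submodule ℂ (Lp ℂ 2 μ) := W.map Tl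
  haveI : FiniteDimensional ℂ W₂ := inferInstanceAs (FiniteDimensional ℂ (W.map Tl))
  let e : W ≃ₗ[ℂ] W₂ := Submodule.equivMapOfInjective Tl hTl W
  let S : W₂ →ₗ[ℂ] C(X, ℂ) := W.subtype ∘ₗ (e.symm : W₂ →ₗ[ℂ] W)
  let S' : W₂ →L[ℂ] C(X, ℂ) := LinearMap.toContinuousLinearMap S
  refine ⟨‖S'‖ ^ 2, fun f hf x => ?_⟩
  -- `f = S' (T f)`
  have hTf : Tl f ∈ W₂ := Submodule.mem_map_of_mem hf
  have he : e ⟨f, hf⟩ = ⟨Tl f, hTf⟩ :=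
    Subtype.ext (Submodule.coe_equivMapOfInjective_apply Tl hTl W ⟨f, hf⟩)
  have hSf : S' ⟨Tl f, hTf⟩ = f := by
    rw [← he]
    simp [S', S]
  -- the sup norm of `f` is controlled by the `L²` norm of `T f`
  have h1 : ‖f x‖ ≤ ‖f‖ := f.norm_coe_le_norm x
  have h2 : ‖f‖ ≤ ‖S'‖ * ‖T f‖ := by
    have := S'.le_opNorm ⟨Tl f, hTf⟩
    rwa [hSf] at this
  -- the `L²` norm of `T f`
  have h3 : ‖T f‖ ^ 2 = ∫ y, ‖f y‖ ^ 2 ∂μ := by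
    have hinner : inner ℂ (T f) (T f) = ((∫ y, ‖f y‖ ^ 2 ∂μ : ℝ) : ℂ) := by
      rw [hT_def, ContinuousMap.inner_toLp, ← integral_complex_ofReal]
      refine integral_congr_ae (Filter.Eventually.of_forall fun y => ?_)
      simp only [Complex.mul_conj', Complex.ofReal_pow]
    rw [@norm_sq_eq_re_inner ℂ _ _ _ _ (T f), hinner]
    simp
  calc ‖f x‖ ^ 2 ≤ ‖f‖ ^ 2 := pow_le_pow_left₀ (norm_nonneg _) h1 2
    _ ≤ (‖S'‖ * ‖T f‖) ^ 2 := pow_le_pow_left₀ (norm_nonneg _) h2 2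
    _ = ‖S'‖ ^ 2 * ∫ y, ‖f y‖ ^ 2 ∂μ := by rw [mul_pow, h3]

/-! ## Step 2: total degree of a determinant of multivariate polynomials -/

/-- If the `(i, j)` entry of a square matrix of multivariate polynomials has total degree at most
`a i + b j` (row weight plus column weight), then its determinant has total degree at most
`∑ i, a i + ∑ j, b j` (expand by the Leibniz formula and reindex the row weights along the
permutation). [folklore] -/
theorem totalDegree_det_le_of_entries {n σ R : Type*} [CommRing R] [Fintype n] [DecidableEq n]
    (M : Matrix n n (MvPolynomial σ R)) (a b : n → ℕ)
    (h : ∀ i j, (M i j).totalDegree ≤ a i + b j) :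
    M.det.totalDegree ≤ ∑ i, a i + ∑ j, b j := by
  rw [Matrix.det_apply]
  refine totalDegree_finsetSum_le fun τ _ => ?_
  have hprod : (∏ i, M (τ i) i).totalDegree ≤ ∑ i, a i + ∑ j, b j := by
    refine (totalDegree_finsetProd _ _).trans ?_
    calc ∑ i, (M (τ i) i).totalDegree ≤ ∑ i, (a (τ i) + b i) :=
          Finset.sum_le_sum fun i _ => h (τ i) i
      _ = ∑ i, a (τ i) + ∑ i, b i := Finset.sum_add_distrib
      _ = ∑ i, a i + ∑ j, b j := by rw [Equiv.sum_comp τ a]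
  rcases Int.units_eq_one_or (Equiv.Perm.sign τ) with hτ | hτ
  · rw [hτ, one_smul]
    exact hprod
  · rw [hτ, Units.neg_smul, one_smul, totalDegree_neg]
    exact hprod

/-! ## Step 3: the one-link fermion determinant is a polynomial of bounded degree -/

/-- Shorthand for the gauge group `SU(3)`. -/
local notation "SU3" => Matrix.specialUnitaryGroup (Fin 3) ℂ

/-- The `18` polynomial variables: entries of the link matrix (`inl`) and of its inverse (`inr`). -/
local notation "LinkVar" => (Fin 3 × Fin 3) ⊕ (Fin 3 × Fin 3)

/-- The coordinate vector of `g ∈ SU(3)` fed to the polynomials: `inl (a, b) ↦ g_{ab}`,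
`inr (a, b) ↦ (g⁻¹)_{ab}`. -/
local notation "⦗" g "⦘" =>
  (Sum.elim
    (fun ab : Fin 3 × Fin 3 => ((g : SU3) : Matrix (Fin 3) (Fin 3) ℂ) (Prod.fst ab) (Prod.snd ab))
    (fun ab : Fin 3 × Fin 3 =>
      (((g : SU3)⁻¹ : SU3) : Matrix (Fin 3) (Fin 3) ℂ) (Prod.fst ab) (Prod.snd ab)) :
    LinkVar → ℂ)

/-- The coordinate map `SU(3) → ℂ¹⁸`, `g ↦ ⦗g⦘`, is continuous (matrix entries, and entries of the
inverse by continuity of inversion on `SU(3)`). [folklore] -/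
theorem continuous_linkCoord : Continuous fun g : SU3 => ⦗g⦘ := by
  refine continuous_pi fun v => ?_
  rcases v with ⟨a, b⟩ | ⟨a, b⟩
  · show Continuous fun g : SU3 => ((g : SU3) : Matrix (Fin 3) (Fin 3) ℂ) a b
    exact continuous_subtype_val.matrix_elem a b
  · show Continuous fun g : SU3 => (((g : SU3)⁻¹ : SU3) : Matrix (Fin 3) (Fin 3) ℂ) a b
    exact (continuous_subtype_val.comp continuous_inv).matrix_elem a b

section Entries

variable {L : ℕ} [DecidableEq (Edge 4 L)] (U : GaugeConfig 4 L SU3) (m r : ℝ) (e : Edge 4 L)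

/-- The `(a, b)` entry of the link matrix at `(y, μ)` of `U[e ↦ g]` is a polynomial in `⦗g⦘` of
total degree `≤ 1` if `y` is the site of `e` and `0` otherwise (the variable `X (inl (a, b))` on
the updated link, a constant elsewhere). [folklore] -/
theorem exists_poly_link (y : Site 4 L) (μ : Fin 4) (a b : Fin 3) :
    ∃ P : MvPolynomial LinkVar ℂ, P.totalDegree ≤ (if y = e.1 then 1 else 0) ∧
      ∀ g : SU3, eval ⦗g⦘ P =
        ((Function.update U e g (y, μ) : SU3) : Matrix (Fin 3) (Fin 3) ℂ) a b := by
  by_cases h : (y, μ) = e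
  · have h1 : y = e.1 := congrArg Prod.fst h
    refine ⟨X (Sum.inl (a, b)), ?_, fun g => ?_⟩
    · rw [if_pos h1, totalDegree_X]
    · simp only [Function.update_apply, if_pos h, eval_X, Sum.elim_inl]
  · refine ⟨C ((U (y, μ) : Matrix (Fin 3) (Fin 3) ℂ) a b), ?_, fun g => ?_⟩
    · rw [totalDegree_C]
      exact Nat.zero_le _
    · rw [Function.update_apply, if_neg h, eval_C]

/-- The `(a, b)` entry of the INVERSE link matrix at `(y, μ)` of `U[e ↦ g]` is a polynomial in
`⦗g⦘` of total degree `≤ 1` if `y` is the site of `e` and `0` otherwise (the variable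
`X (inr (a, b))` on the updated link, a constant elsewhere). [folklore] -/
theorem exists_poly_linkInv (y : Site 4 L) (μ : Fin 4) (a b : Fin 3) :
    ∃ P : MvPolynomial LinkVar ℂ, P.totalDegree ≤ (if y = e.1 then 1 else 0) ∧
      ∀ g : SU3, eval ⦗g⦘ P =
        (((Function.update U e g (y, μ))⁻¹ : SU3) : Matrix (Fin 3) (Fin 3) ℂ) a b := by
  by_cases h : (y, μ) = e
  · have h1 : y = e.1 := congrArg Prod.fst h
    refine ⟨X (Sum.inr (a, b)), ?_, fun g => ?_⟩
    · rw [if_pos h1, totalDegree_X]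
    · simp only [Function.update_apply, if_pos h, eval_X, Sum.elim_inr]
  · refine ⟨C ((((U (y, μ))⁻¹ : SU3) : Matrix (Fin 3) (Fin 3) ℂ) a b), ?_, fun g => ?_⟩
    · rw [totalDegree_C]
      exact Nat.zero_le _
    · rw [Function.update_apply, if_neg h, eval_C]

/-- Every entry of `wilsonDirac ρ (U[e ↦ g]) m r` (fundamental representation) is a polynomial in
`⦗g⦘` of total degree at most (row weight `[p.1 = e.1]`) + (column weight `[q.1 = e.1]`): the
polynomial mirrors the definition of `wilsonDirac` term by term, with `g` entering the forward
hops out of the site `e.1` and `g⁻¹` the backward hops into it. [folklore] -/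
theorem exists_poly_entry (p q : TorusSite 4 L × Fin 3 × Fin 4) :
    ∃ P : MvPolynomial LinkVar ℂ,
      P.totalDegree ≤ (if p.1 = e.1 then 1 else 0) + (if q.1 = e.1 then 1 else 0) ∧
      ∀ g : SU3, eval ⦗g⦘ P =
        wilsonDirac (fundamentalRep (Fin 3)) (Function.update U e g) m r p q := by
  choose A hAdeg hAeval using fun μ : Fin 4 => exists_poly_link U e p.1 μ p.2.1 q.2.1
  choose B hBdeg hBeval using fun μ : Fin 4 => exists_poly_linkInv U e q.1 μ p.2.1 q.2.1
  refine ⟨(if p = q then C (((m + 4 * r : ℝ) : ℂ)) else 0) -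
    C (1 / 2 : ℂ) * ∑ μ : Fin 4,
      ((if q.1 = Site.shift p.1 μ then
          C (((r : ℂ) • (1 : Matrix (Fin 4) (Fin 4) ℂ) - euclideanGamma μ) p.2.2 q.2.2) * A μ
        else 0) +
        (if p.1 = Site.shift q.1 μ then
          C (((r : ℂ) • (1 : Matrix (Fin 4) (Fin 4) ℂ) + euclideanGamma μ) p.2.2 q.2.2) * B μ
        else 0)), ?_, fun g => ?_⟩
  · -- degree bound (the weights are generalised so that `split_ifs` only splits the hops)
    generalize (if p.1 = e.1 then 1 else 0 : ℕ) = a at hAdeg ⊢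
    generalize (if q.1 = e.1 then 1 else 0 : ℕ) = b at hBdeg ⊢
    refine (totalDegree_sub _ _).trans (max_le ?_ ?_)
    · split_ifs
      · rw [totalDegree_C]
        exact Nat.zero_le _
      · rw [totalDegree_zero]
        exact Nat.zero_le _
    · refine (totalDegree_mul _ _).trans ?_
      rw [totalDegree_C, zero_add]
      refine totalDegree_finsetSum_le fun μ _ => (totalDegree_add _ _).trans (max_le ?_ ?_)
      · split_ifs
        · refine (totalDegree_mul _ _).trans ?_
          rw [totalDegree_C, zero_add]
          exact (hAdeg μ).trans (Nat.le_add_right _ _)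
        · rw [totalDegree_zero]
          exact Nat.zero_le _
      · split_ifs
        · refine (totalDegree_mul _ _).trans ?_
          rw [totalDegree_C, zero_add]
          exact (hBdeg μ).trans (Nat.le_add_left _ _)
        · rw [totalDegree_zero]
          exact Nat.zero_le _
  · -- evaluation: push `eval` through and compare with the definition of `wilsonDirac`
    simp only [wilsonDirac, Matrix.of_apply, map_sub, map_mul, map_add, map_sum, eval_C,
      apply_ite (eval ⦗g⦘), map_zero, hAeval, hBeval, fundamentalRep_apply]

omit [DecidableEq (Edge 4 L)] in
/-- The number of (site, colour, spin) indices at a given site is `12`. [folklore] -/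
theorem sum_ite_fst_eq [NeZero L] :
    ∑ p : TorusSite 4 L × Fin 3 × Fin 4, (if p.1 = e.1 then 1 else 0 : ℕ) = 12 := by
  calc ∑ p : TorusSite 4 L × Fin 3 × Fin 4, (if p.1 = e.1 then 1 else 0 : ℕ)
      = ∑ x : TorusSite 4 L, ∑ _s : Fin 3 × Fin 4, (if x = e.1 then 1 else 0 : ℕ) :=
        Fintype.sum_prod_type _
    _ = ∑ x : TorusSite 4 L, (if x = e.1 then 12 else 0 : ℕ) := by
        refine Finset.sum_congr rfl fun x _ => ?_
        split_ifs <;> simp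
    _ = 12 := by simp

/-- **The one-link determinant is a bounded-degree polynomial.** For every torus, background `U`,
mass, Wilson parameter and edge `e` there is a polynomial `Q` of total degree `≤ 24` in the `18`
link variables with `det (wilsonDirac ρ (U[e ↦ g]) m r) = Q(⦗g⦘)` for all `g ∈ SU(3)`
(`totalDegree_det_le_of_entries` with the weights of `exists_poly_entry`, `12 + 12 = 24`). [folklore] -/
theorem det_wilsonDirac_update_eq_eval [NeZero L] :
    ∃ Q ∈ restrictTotalDegree LinkVar ℂ 24, ∀ g : SU3,
      (wilsonDirac (fundamentalRep (Fin 3)) (Function.update U e g) m r).det = eval ⦗g⦘ Q := by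
  choose P hPdeg hPeval using exists_poly_entry U m r e
  refine ⟨(Matrix.of P).det, ?_, fun g => ?_⟩
  · rw [mem_restrictTotalDegree]
    have h := totalDegree_det_le_of_entries (Matrix.of P)
      (fun p => if p.1 = e.1 then 1 else 0) (fun q => if q.1 = e.1 then 1 else 0)
      (fun p q => hPdeg p q)
    rw [sum_ite_fst_eq] at h
    exact h
  · rw [RingHom.map_det]
    congr 1
    ext p q
    simp only [RingHom.mapMatrix_apply, Matrix.map_apply, Matrix.of_apply, hPeval]

end Entries

/-! ## Assembly -/

/-- **Single-link flatness** (`SingleLinkFlatness`, item stmt-QuantumFields-11515): there is one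
constant `C` such that for all `L ≥ 1`, backgrounds `U`, bare masses `m₀`, edges `e` and
`g₀ ∈ SU(3)`, `‖det D_W(U[e ↦ g₀]; m₀, 1)‖² ≤ C ∫ ‖det D_W(U[e ↦ g]; m₀, 1)‖² dHaar(g)`.
Proof: the functions `g ↦ det D_W(U[e ↦ g])` all lie in the fixed finite-dimensional space of
evaluations along `SU(3)` of polynomials of total degree `≤ 24` in the `18` link variables
(`det_wilsonDirac_update_eq_eval`), on which the Nikolskii-type inequality
`exists_sq_le_mul_integral_sq` holds for the Haar probability measure (which charges every
non-empty open set). [folklore] -/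
theorem singleLinkFlatness_proof :
    Summit.QuantumFields.QCD.Theses.PauliWegnerSea.SingleLinkFlatness := by
  unfold Summit.QuantumFields.QCD.Theses.PauliWegnerSea.SingleLinkFlatness
  haveI : (haarProbability SU3).IsOpenPosMeasure := by
    unfold haarProbability; infer_instance
  -- evaluation along `SU(3)` of polynomials in the link variables, a linear map into `C(SU(3), ℂ)`
  let T : MvPolynomial LinkVar ℂ →ₗ[ℂ] C(SU3, ℂ) :=
    { toFun := fun Q => ⟨fun g => eval ⦗g⦘ Q, (continuous_eval Q).comp continuous_linkCoord⟩
      map_add' := fun Q₁ Q₂ => by ext g; simp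
      map_smul' := fun c Q => by ext g; simp [smul_eval] }
  have hT : ∀ (Q : MvPolynomial LinkVar ℂ) (g : SU3), T Q g = eval ⦗g⦘ Q := fun Q g => rfl
  obtain ⟨C, hC⟩ := exists_sq_le_mul_integral_sq (haarProbability SU3)
    ((restrictTotalDegree LinkVar ℂ 24).map T)
  refine ⟨C, fun L _ U m₀ e g₀ => ?_⟩
  obtain ⟨Q, hQ, hQeval⟩ := det_wilsonDirac_update_eq_eval U m₀ 1 e
  have key := hC (T Q) (Submodule.mem_map_of_mem hQ) g₀
  simp only [hT, ← hQeval] at key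
  exact key

end Summit.QuantumFields.QCD.Theorems.PauliWegnerSea
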